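import Summits.AtomisticToContinuum.FouriersLaw.Theses.EmbeddedDrudeMourre
import Literature.MathematicalPhysics.KineticTheory.InfiniteChainSuperstableDynamics
import Literature.MathematicalPhysics.KineticTheory.InfiniteChainInvariantStates

/-!
# Line `heated-measure-thermal-exponent` for crux `GreenKuboContinuation` (stmt-AtomisticToContinuum-12597)

Crux (route `EmbeddedDrudeMourre`, rank 5): for `pinnedChain ω₂ lam β γ` (all `> 0`) and `T₀ > 0`,
Abelian Green–Kubo witnesses `W T` at every `T ∈ (0, T₀)` ⇒ `W T` at every `T > 0`, where
`W T = ∃ μ D κ, Gibbs_T μ ∧ D preserves μ ∧ (∀ t, abs. convergent C) ∧ 0 < κ ∧ T⁻²A(ν) → κ (ν ↓ 0)`,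
`A(ν) = ∫₀^∞ e^{-νt} C(t) dt`, `C = D.currentCorrelation μ`.

## The line (idea card `Ideas/heated-measure-thermal-exponent.md`, triage r1: 3 × pass)

HEAT THE MEASURE, NOT THE DYNAMICS. At fixed couplings the Hamiltonian flow does not depend on `T`:
it is ONE object — the Buttà–Marchioro dynamics on its superstable set `𝒳₀ = bmGood` (Thm 2.1,
PROVED in tree: `OscillatorChain.ButtaMarchioro2016_thm21_chain_holds`, unique on `𝒳₀`, so
"`D.carrier = bmGood`" pins the physical flow) — and only the invariant shift-invariant Gibbs state
`μ_T` moves with `T`. The crux becomes a one-dimensional TRANSPORT problem for the function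
`T ↦ A_T(ν)` of ONE heated pair `(D, μ_T)`, seeded ONCE by the corner hypothesis at `T₁ := T₀/2`;
the modulus that transports is the THERMAL EXPONENT `x(T, ν) = T ∂_T log A_T(ν)` (an exact static
energy-insertion third cumulant, `x = κ₃(H, Q_ν, Q_ν)/(T⟨Q_ν²⟩)` by momentum-reversal parity), used
here only in INTEGRATED, RELATIVE, SIGN-FREE form:

* `stub_heatableInfrastructure` (A, size L, print-level): one dynamics with carrier `bmGood` and,
  at every `T > 0`, a shift-invariant DLR Gibbs state it preserves, with absolutely convergent,
  continuous, `C(0)`-bounded summed current autocorrelation (BM 2016 Thm 2.1/2.2 + (2.6) in tree;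
  1-D transfer operator; invariance of tempered Gibbs states under the limit of severed flows).
* `stub_seedTransfer` (B, size L): the SEAM — a witness at `T₁` (arbitrary Gibbs state, arbitrary
  dynamics, as the crux's hypothesis hands it over) forces the PHYSICAL heated pair at the same `T₁`
  to be a witness (identification: DLR states carrying a conducting invariant dynamics vs the
  shift-invariant superstable one; a.e. uniqueness of the flow on `bmGood`). No transport in `T`.
* `stub_boundedThermalExponent` (K1, the HARDEST, rank-2 content of the card): for two admissible
  heated states at `T, T'` the Abel functionals are comparable, `m·A_{T'}(ν) ≤ A_T(ν)` for all
  `ν ∈ (0, 1]` with `m = m(T, T') > 0` INDEPENDENT OF `ν` — the integrated form of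
  `sup |x(·, ν)| ≤ a` on `[T ∧ T', T ∨ T']` (`m = (T ∨ T'/T ∧ T')^{-a}`, Gronwall in `log T`);
  two-sided by the symmetry `T ↔ T'`; it presupposes neither finiteness nor positivity of any Abel
  limit (harmonic sanity check: `A_T = cT²/ν`, `x ≡ 2`, K1 true while `W` fails everywhere).
* `stub_thermalExponentConverges` (K2′, replaces the card's engine-free K2 as all three triagers
  asked): the RATIO `A_T(ν)/A_{T'}(ν)` has a limit as `ν ↓ 0` — the integrated form of
  "`x(·, ν)` converges as `ν ↓ 0`, locally uniformly" (`log(A_T/A_{T'}) = ∫_{T'}^{T} x(S, ν) dS/S`);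
  it TRANSPORTS EXISTENCE of the Abel limit from the seed and is what positivity/Gronwall cannot
  give (triage evidence `Tight35.thermalExponent_tightness`, `Triage.two_sided_bounds_no_limit`,
  Disproof §6 `abelLimit_not_weakly_closed`). Alternative discharge: the relative all-orders bound
  + `RealVitaliPropagation` of card temperature-blind-vitali-hurwitz (merge proposal of the panel).

`GreenKuboContinuation_of : A → B → K1 → K2′ → GreenKuboContinuation` is proved below (real
analysis of limits; no sorry): seed `A_{T₁}(ν) → κ₁T₁² > 0` (B on the corner witness at
`T₁ = T₀/2`), ratio `→ r` (K2′), `r ≥ m > 0` (K1), hence `T⁻²A_T(ν) → T⁻² r κ₁ T₁² > 0`, and the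
infrastructure clauses of `W T` come from A.

## Disproof used (`Cruxes/GreenKuboContinuation/Disproof.lean`, cdisprove cycle 2 v3)

§1 `continuesAlong_iff_exists` / `not_continuesAlong_lt_one`: the corner is used existentially and
exactly once (B at `T₁ = T₀/2`), and chain input is indispensable — it enters through A (BM flow,
Gibbs states) and the physical stubs K1/K2′; §2b–c (`laxWitness_all_temp`, junk inhabitants,
`not_tendsto_abel_of_junk_integral`): every stub keeps the Gibbs clause and `0 < κ`, the heated
pair is the BM flow on `bmGood` (never `restDynamics`), and the admissibility conjunction carries
continuity + `|C| ≤ C(0)` so that no Abel functional in K1/K2′ is Bochner junk; §2c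
`not_tendsto_of_drude_floor` + barrier `Mazur1969_inequality`: a hidden odd conserved charge at an
interior `T*` makes `A_{T*}(ν) ≍ d/ν`, so K1 FAILS at pairs `(T*, T₁)` — correctly, the line is
not conservation-law blind; §4 `greenKuboContinuation_iff_allT_of_corner`: no stub is
`AbelianGreenKuboAllT` or the crux reworded — A is witness-free infrastructure, B is a
same-temperature identification, K1/K2′ are RELATIVE statements true at the harmonic point where
`W` fails at every `T`; §5 `abelFunctional_smul` / `greenKuboContinuation_iff_ray'`: RAY FORM of
K1 for the MD falsifier — `T⁻²A_T(ν; lam, β) = A_1(ν; lamT, βT)`, so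
`x(T, ν) = 2 + c ∂_c log A_1(ν; lam c, β c)|_{c=T}` and `m(T,T')` is read off unit-temperature
ray scans (kit j005961 of the ideator); §6 `abelLimit_not_weakly_closed`,
`corner_vanishing_not_smooth_rigid`, `no_witness_of_pseudogap`: existence is carried by K2′ (not by
bounds), positivity by K1's lower bound (no pseudogap can open between `T₁` and `T`), nothing
relies on smooth-rigidity. No `_false_without_` theorem or landed `Negative/` lemma exists for this
crux at the time of writing (checked `ledger crux ls`, 2026-08-16).
-/

noncomputable section

namespace Summit.AtomisticToContinuum.FouriersLaw.Cruxes.GreenKuboContinuation.HeatedMeasureThermalExponent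

open MeasureTheory Filter Set Topology
open Literature.MathematicalPhysics.KineticTheory.HeatConduction

/-- **Stub A — `HeatableInfrastructure`** (size L; print-level infrastructure, shared in substance
with `FourierGreenKubo.InfiniteVolumeSetup` stmt-0743 and `CurrentTiltQuench.SymmetricSetup`
stmt-11036, but with ONE dynamics for ALL temperatures). For `pinnedChain ω₂ lam β γ` (all `> 0`)
there is an infinite-volume dynamics `D` whose carrier is the Buttà–Marchioro superstable set
`𝒳₀ = bmGood` (exists and is unique there: `OscillatorChain.ButtaMarchioro2016_thm21_chain_holds`,
`….exists_dynamics_pinnedChain`; the prover chooses the measurable version of the flow off `𝒳₀`)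
such that for every `T > 0` some DLR Gibbs state `μ_T` is shift-invariant, carried by `𝒳₀` and
preserved by `D` (superstability estimate (2.3) for the translation-invariant Gibbs state ⇒
`μ_T(𝒳₀ᶜ) = 0` by the PROVED `ButtaMarchioro2016_eq26_chain_holds`; invariance: DLR kernels are
invariant under the severed flows, pass to the limit flow), with absolutely convergent summed
current autocorrelation `C_T(t) = Σ_x ∫ j₀ (j_x ∘ φ_t) dμ_T` at every `t` (almost-linear light cone,
BM Thm 2.2 `ButtaMarchioro2016_thm22_chain_holds`, + spatial mixing of the 1-D Gibbs state),
`t ↦ C_T(t)` continuous and `|C_T(t)| ≤ C_T(0)` (stationarity + positive-definiteness: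
`C_T(t) = ⟪[j], U_t[j]⟫` on Doyon's zero-wavenumber space, cf. `ZeroWavenumberSpace`).
Why it might fail: only by mis-assembly — each clause is standard for tempered states of
superstable 1-D chains; the one unprinted step is invariance of the infinite-volume Gibbs state
under the BM flow for quartic `V` (LLL 1977 §4 remark (i) is for severed flows).
Sources: ButtaMarchioro2016 (arXiv:1602.01294) Thm 2.1–2.2, (2.6); LanfordLebowitzLieb1977 §4;
Georgii2011 (1-D transfer operator); Doyon2022. -/
theorem stub_heatableInfrastructure :
    ∀ ω₂ lam β γ : ℝ, 0 < ω₂ → 0 < lam → 0 < β → 0 < γ →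
      ∃ D : InfiniteChainDynamics (pinnedChain ω₂ lam β γ),
        D.carrier = (pinnedChain ω₂ lam β γ).bmGood ∧
        ∀ T : ℝ, 0 < T → ∃ μ : Measure ChainConfig,
          ((pinnedChain ω₂ lam β γ).IsChainGibbsMeasure T μ ∧ IsShiftInvariant μ ∧ D.PreservesMeasure μ ∧
          (∀ t : ℝ, D.HasAbsConvergentCorrelation μ t) ∧ Continuous (D.currentCorrelation μ) ∧
          ∀ t : ℝ, |D.currentCorrelation μ t| ≤ D.currentCorrelation μ 0) := by
  sorry

/-- **Stub B — `SeedTransfer`** (size L; the seam between the crux's hypothesis and the heated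
pair; NO transport in `T`). If `pinnedChain ω₂ lam β γ` has ANY Abelian Green–Kubo witness at
`T₁` (arbitrary DLR state `μ₁`, arbitrary `μ₁`-preserving dynamics `D₁` — verbatim the crux's
`W T₁`), then the PHYSICAL heated pair at `T₁` — the BM flow (`D.carrier = bmGood`) with any
admissible shift-invariant Gibbs state `μ` at `T₁` — is itself a witness: `T₁⁻²A_{D,μ}(ν) → κ₁`
for some `κ₁ > 0` (not claimed equal to the witness's `κ`). Intended proof: a DLR state carrying
an invariant dynamics with summable current correlations and a FINITE Abel limit is the
shift-invariant superstable state (exotic = boundary-condition-at-infinity states add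
non-decaying, Drude-type terms to `C`, as the harmonic shifts `φ ↦ φ + h`, `(ω₂+2)h = h₊ + h₋`,
do: there `Σ_x λ^x K_t(x) = T cos(ω(i log λ)t) ≡ T`), and two `μ`-preserving solution flows agree
`μ`-a.e. with the BM flow on `𝒳₀` (uniqueness clause of Thm 2.1); then `C_{D₁,μ₁} = C_{D,μ}`.
Why it might fail: an exotic (non-translation-invariant / non-tempered) DLR state of the pinned
chain carrying a conducting invariant dynamics with a DIFFERENT low-frequency current spectrum
than the physical state — DLR uniqueness without temperedness is false already for the harmonic
chain (Georgii2011 Ch. 13), so the proof must go through the witness property, not bare DLR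
uniqueness. Honours Disproof §2b–c (Gibbs clause and `0 < κ` kept on both sides; junk dynamics
give no witness) and §1 (`∀T₀ ≡ ∃T₀`: used once, at `T₁ = T₀/2`).
Sources: Georgii2011 Ch. 10–11, 13; LanfordLebowitzLieb1977 Thm 3–4; ButtaMarchioro2016 Thm 2.1;
BonettoLebowitzReyBellet2000 §7. -/
theorem stub_seedTransfer :
    ∀ ω₂ lam β γ : ℝ, 0 < ω₂ → 0 < lam → 0 < β → 0 < γ → ∀ T₁ : ℝ, 0 < T₁ →
      (∃ (μ₁ : Measure ChainConfig) (D₁ : InfiniteChainDynamics (pinnedChain ω₂ lam β γ)) (κ : ℝ),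
        (pinnedChain ω₂ lam β γ).IsChainGibbsMeasure T₁ μ₁ ∧ D₁.PreservesMeasure μ₁ ∧
          (∀ t : ℝ, D₁.HasAbsConvergentCorrelation μ₁ t) ∧ 0 < κ ∧
          Tendsto (fun ν : ℝ => (T₁ ^ 2)⁻¹ * ∫ t in Ioi (0 : ℝ), Real.exp (-(ν * t)) * D₁.currentCorrelation μ₁ t)
            (𝓝[>] (0 : ℝ)) (𝓝 κ)) →
      ∀ (D : InfiniteChainDynamics (pinnedChain ω₂ lam β γ)) (μ : Measure ChainConfig),
        D.carrier = (pinnedChain ω₂ lam β γ).bmGood →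
        ((pinnedChain ω₂ lam β γ).IsChainGibbsMeasure T₁ μ ∧ IsShiftInvariant μ ∧ D.PreservesMeasure μ ∧
          (∀ t : ℝ, D.HasAbsConvergentCorrelation μ t) ∧ Continuous (D.currentCorrelation μ) ∧
          ∀ t : ℝ, |D.currentCorrelation μ t| ≤ D.currentCorrelation μ 0) →
        ∃ κ₁ : ℝ, 0 < κ₁ ∧
          Tendsto (fun ν : ℝ => (T₁ ^ 2)⁻¹ * ∫ t in Ioi (0 : ℝ), Real.exp (-(ν * t)) * D.currentCorrelation μ t)
            (𝓝[>] (0 : ℝ)) (𝓝 κ₁) := by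
  sorry

/-- **Stub K1 — `BoundedThermalExponent`** (THE HARDEST STUB; the card's rank-2 crux K1 in
integrated form). For the BM flow `D` and admissible heated states `μ` at `T`, `μ'` at `T'`
(both `> 0`): `∃ m > 0, ∀ ν ∈ (0,1], m · A_{T'}(ν) ≤ A_T(ν)`, `A_T(ν) = ∫₀^∞ e^{-νt} C_T(t) dt` —
the constant is UNIFORM IN `ν` (that is the whole content); by the symmetry `T ↔ T'` the bound is
two-sided. It is the integral of the thermal-exponent bound `|T ∂_T log A_T(ν)| ≤ a` on
`[T ∧ T', T ∨ T']` (Gronwall in `log T`, `m = (T∨T'/T∧T')^{-a}`), where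
`T² ∂_T A_T(ν) = Σ_x Cov_T(h_x ; j₀ R_ν)`, `R_ν = Σ_y ∫₀^∞ e^{-νt} j_y∘φ_t dt` (static energy
insertion under ONE flow: DLR equations of `chainSpecification` + dominated differentiation), and
by `Θ`-parity (`J` odd, `H` even, `Cov_T(H, Q_ν) = 0`) `x = κ₃(H, Q_ν, Q_ν)/(T⟨Q_ν²⟩)` is an
intensive THIRD-CUMULANT ratio — the lead's `--supports` lemmas live there. RELATIVE and
SIGN-FREE: presupposes neither finiteness nor positivity of any Abel limit (harmonic check
`A_T = cT²/ν`: `x ≡ 2`, K1 true, `W` false everywhere — Disproof §2c `not_tendsto_of_drude_floor`);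
anchors: `x → 0` at the kinetic corner (`πg_T(0) ∝ lam⁻²`), `x → 9/4` at the scale-free quartic
end of every ray, `x_stat ∈ [2, 5/2]`. RAY FORM for numerics (Disproof §5 / tree
`abelFunctional_smul`): `x(T,ν) = 2 + c∂_c log A_1(ν; lam c, β c)|_{c=T}`.
Why it might fail: a genuine transport singularity at an interior `T*` — `κ_A` not log-Lipschitz
(hidden odd conserved charge ⇒ `A_{T*} ≍ d/ν`, Mazur; Klages-type fractal parameter dependence,
known only for parameters in the DYNAMICS, doi:10.1103/physreve.59.5361, arXiv:0801.2413) — or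
`ν`-NON-uniformity: `P_ν = (ν/2)(Q₊² + Q₋²)` has support `∼ v/ν`, so the energy shift is naively
`O(1/ν)` and K1 asserts its cancellation to `O(1)`; on rays with `β ≪ lam` the De Roeck–Huveneers
window makes `x` large of both signs (finite) — hence no signed variant is claimed
(barrier `AnticontinuumLocalizationNarrow`: it bites quantitatively, the bet is log-Lipschitz).
Sources: card heated-measure-thermal-exponent; AokiLukkarinenSpohn2006 §3, §5; LiLi2007
(arXiv:cond-mat/0703567) p.4; KomorowskiLandimOlla2012 Ch. 4 (doi:10.1007/978-3-642-29880-6_4);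
BonettoLebowitzReyBellet2000 §6.3 (35); DeRoeckHuveneers2015; Mazur1969. -/
theorem stub_boundedThermalExponent :
    ∀ ω₂ lam β γ : ℝ, 0 < ω₂ → 0 < lam → 0 < β → 0 < γ →
      ∀ (D : InfiniteChainDynamics (pinnedChain ω₂ lam β γ)), D.carrier = (pinnedChain ω₂ lam β γ).bmGood →
      ∀ T T' : ℝ, 0 < T → 0 < T' → ∀ μ μ' : Measure ChainConfig,
        ((pinnedChain ω₂ lam β γ).IsChainGibbsMeasure T μ ∧ IsShiftInvariant μ ∧ D.PreservesMeasure μ ∧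
          (∀ t : ℝ, D.HasAbsConvergentCorrelation μ t) ∧ Continuous (D.currentCorrelation μ) ∧
          ∀ t : ℝ, |D.currentCorrelation μ t| ≤ D.currentCorrelation μ 0) →
        ((pinnedChain ω₂ lam β γ).IsChainGibbsMeasure T' μ' ∧ IsShiftInvariant μ' ∧ D.PreservesMeasure μ' ∧
          (∀ t : ℝ, D.HasAbsConvergentCorrelation μ' t) ∧ Continuous (D.currentCorrelation μ') ∧
          ∀ t : ℝ, |D.currentCorrelation μ' t| ≤ D.currentCorrelation μ' 0) →
        ∃ m : ℝ, 0 < m ∧ ∀ ν : ℝ, ν ∈ Ioc (0 : ℝ) 1 →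
          m * (∫ t in Ioi (0 : ℝ), Real.exp (-(ν * t)) * D.currentCorrelation μ' t) ≤
            ∫ t in Ioi (0 : ℝ), Real.exp (-(ν * t)) * D.currentCorrelation μ t := by
  sorry

/-- **Stub K2′ — `ThermalExponentConverges`** (existence transport; replaces the card's K2 per
triage r1-1/2/3). For the BM flow `D` and admissible heated states `μ` at `T`, `μ'` at `T'`: the
ratio `A_T(ν)/A_{T'}(ν)` converges to a real limit as `ν ↓ 0`. Integrated form of "the thermal
exponent `x(·, ν)` converges as `ν ↓ 0` in `L¹(dS/S)` on `[T∧T', T∨T']`" (e.g. locally uniformly,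
the card's K2′), since `log(A_T(ν)/A_{T'}(ν)) = ∫_{T'}^{T} x(S,ν) dS/S`; spectrally: the Poisson
smoothings at `0` of the current spectral measures `σ_T`, `σ_{T'}` are asymptotically
PROPORTIONAL — a statement about the `T`-dependence of the low-frequency LINESHAPE only. RELATIVE:
true at the harmonic point (ratio `(T/T')²`) where no Abel limit exists at any `T`; it is what
transports EXISTENCE of `lim_ν A_T(ν)` from the seed `T₁` to `T` (bounds cannot:
`Triage.two_sided_bounds_no_limit`, `Tight35.thermalExponent_tightness`, Disproof §6
`abelLimit_not_weakly_closed`). Alternative discharge: relative all-orders (Gevrey-1) bounds on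
`∂ᵏ_{1/T} log A_T(ν)` uniform in `ν` + `RealVitaliPropagation` (card temperature-blind-vitali-hurwitz;
the panel's merge proposal) give convergence of `A_T(ν)` itself on compacts, hence of the ratio.
Why it might fail: persistent `log(1/ν)`-scale oscillation of the running conductivity whose PHASE
depends on `T` (a `T`-dependent version of the density `2 + sin log(1/|ω|)` near `0`): no example
or mechanism is known for a translation-invariant non-integrable chain (for reversible stochastic
perturbations the limit exists by monotonicity — here nothing is monotone); Loomis 1943 /
Karamata–Stieltjes index ½ is the exact equivalence with the symmetric derivative of `σ_T` at `0`.
Sources: card heated-measure-thermal-exponent (K2/K2′); TRIAGE-r1-1/2/3; KomorowskiLandimOlla2012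
Ch. 4; BonettoLebowitzReyBellet2000 §6.3. -/
theorem stub_thermalExponentConverges :
    ∀ ω₂ lam β γ : ℝ, 0 < ω₂ → 0 < lam → 0 < β → 0 < γ →
      ∀ (D : InfiniteChainDynamics (pinnedChain ω₂ lam β γ)), D.carrier = (pinnedChain ω₂ lam β γ).bmGood →
      ∀ T T' : ℝ, 0 < T → 0 < T' → ∀ μ μ' : Measure ChainConfig,
        ((pinnedChain ω₂ lam β γ).IsChainGibbsMeasure T μ ∧ IsShiftInvariant μ ∧ D.PreservesMeasure μ ∧
          (∀ t : ℝ, D.HasAbsConvergentCorrelation μ t) ∧ Continuous (D.currentCorrelation μ) ∧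
          ∀ t : ℝ, |D.currentCorrelation μ t| ≤ D.currentCorrelation μ 0) →
        ((pinnedChain ω₂ lam β γ).IsChainGibbsMeasure T' μ' ∧ IsShiftInvariant μ' ∧ D.PreservesMeasure μ' ∧
          (∀ t : ℝ, D.HasAbsConvergentCorrelation μ' t) ∧ Continuous (D.currentCorrelation μ') ∧
          ∀ t : ℝ, |D.currentCorrelation μ' t| ≤ D.currentCorrelation μ' 0) →
        ∃ r : ℝ, Tendsto (fun ν : ℝ =>
            (∫ t in Ioi (0 : ℝ), Real.exp (-(ν * t)) * D.currentCorrelation μ t) /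
              ∫ t in Ioi (0 : ℝ), Real.exp (-(ν * t)) * D.currentCorrelation μ' t)
          (𝓝[>] (0 : ℝ)) (𝓝 r) := by
  sorry

/-- **Composition (kernel-checked, no `sorry`): A → B → K1 → K2′ → `GreenKuboContinuation`.**
Given the corner hypothesis on `(0, T₀)` and a target `T > 0`: take the heated pair `(D, μ_·)` of
A; seed `T₁ := T₀/2`; B turns the corner witness at `T₁` into `T₁⁻²A_{μ₁}(ν) → κ₁ > 0`; K2′ gives
`A_{μ_T}(ν)/A_{μ₁}(ν) → r`; K1 gives `m A_{μ₁} ≤ A_{μ_T}` on `(0,1]`, so `r ≥ m > 0`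
(`ge_of_tendsto`); hence `A_{μ_T}(ν) = ratio · A_{μ₁}(ν) → r κ₁ T₁²` eventually (where
`A_{μ₁}(ν) > 0`), and `κ := T⁻² r κ₁ T₁² > 0` with the Gibbs / preservation / absolute-convergence
clauses of `W T` supplied by A. -/
theorem GreenKuboContinuation_of :
    (∀ ω₂ lam β γ : ℝ, 0 < ω₂ → 0 < lam → 0 < β → 0 < γ →
      ∃ D : InfiniteChainDynamics (pinnedChain ω₂ lam β γ),
        D.carrier = (pinnedChain ω₂ lam β γ).bmGood ∧
        ∀ T : ℝ, 0 < T → ∃ μ : Measure ChainConfig,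
          ((pinnedChain ω₂ lam β γ).IsChainGibbsMeasure T μ ∧ IsShiftInvariant μ ∧ D.PreservesMeasure μ ∧
          (∀ t : ℝ, D.HasAbsConvergentCorrelation μ t) ∧ Continuous (D.currentCorrelation μ) ∧
          ∀ t : ℝ, |D.currentCorrelation μ t| ≤ D.currentCorrelation μ 0)) →
    (∀ ω₂ lam β γ : ℝ, 0 < ω₂ → 0 < lam → 0 < β → 0 < γ → ∀ T₁ : ℝ, 0 < T₁ →
      (∃ (μ₁ : Measure ChainConfig) (D₁ : InfiniteChainDynamics (pinnedChain ω₂ lam β γ)) (κ : ℝ),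
        (pinnedChain ω₂ lam β γ).IsChainGibbsMeasure T₁ μ₁ ∧ D₁.PreservesMeasure μ₁ ∧
          (∀ t : ℝ, D₁.HasAbsConvergentCorrelation μ₁ t) ∧ 0 < κ ∧
          Tendsto (fun ν : ℝ => (T₁ ^ 2)⁻¹ * ∫ t in Ioi (0 : ℝ), Real.exp (-(ν * t)) * D₁.currentCorrelation μ₁ t)
            (𝓝[>] (0 : ℝ)) (𝓝 κ)) →
      ∀ (D : InfiniteChainDynamics (pinnedChain ω₂ lam β γ)) (μ : Measure ChainConfig),
        D.carrier = (pinnedChain ω₂ lam β γ).bmGood →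
        ((pinnedChain ω₂ lam β γ).IsChainGibbsMeasure T₁ μ ∧ IsShiftInvariant μ ∧ D.PreservesMeasure μ ∧
          (∀ t : ℝ, D.HasAbsConvergentCorrelation μ t) ∧ Continuous (D.currentCorrelation μ) ∧
          ∀ t : ℝ, |D.currentCorrelation μ t| ≤ D.currentCorrelation μ 0) →
        ∃ κ₁ : ℝ, 0 < κ₁ ∧
          Tendsto (fun ν : ℝ => (T₁ ^ 2)⁻¹ * ∫ t in Ioi (0 : ℝ), Real.exp (-(ν * t)) * D.currentCorrelation μ t)
            (𝓝[>] (0 : ℝ)) (𝓝 κ₁)) →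
    (∀ ω₂ lam β γ : ℝ, 0 < ω₂ → 0 < lam → 0 < β → 0 < γ →
      ∀ (D : InfiniteChainDynamics (pinnedChain ω₂ lam β γ)), D.carrier = (pinnedChain ω₂ lam β γ).bmGood →
      ∀ T T' : ℝ, 0 < T → 0 < T' → ∀ μ μ' : Measure ChainConfig,
        ((pinnedChain ω₂ lam β γ).IsChainGibbsMeasure T μ ∧ IsShiftInvariant μ ∧ D.PreservesMeasure μ ∧
          (∀ t : ℝ, D.HasAbsConvergentCorrelation μ t) ∧ Continuous (D.currentCorrelation μ) ∧
          ∀ t : ℝ, |D.currentCorrelation μ t| ≤ D.currentCorrelation μ 0) →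
        ((pinnedChain ω₂ lam β γ).IsChainGibbsMeasure T' μ' ∧ IsShiftInvariant μ' ∧ D.PreservesMeasure μ' ∧
          (∀ t : ℝ, D.HasAbsConvergentCorrelation μ' t) ∧ Continuous (D.currentCorrelation μ') ∧
          ∀ t : ℝ, |D.currentCorrelation μ' t| ≤ D.currentCorrelation μ' 0) →
        ∃ m : ℝ, 0 < m ∧ ∀ ν : ℝ, ν ∈ Ioc (0 : ℝ) 1 →
          m * (∫ t in Ioi (0 : ℝ), Real.exp (-(ν * t)) * D.currentCorrelation μ' t) ≤
            ∫ t in Ioi (0 : ℝ), Real.exp (-(ν * t)) * D.currentCorrelation μ t) →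
    (∀ ω₂ lam β γ : ℝ, 0 < ω₂ → 0 < lam → 0 < β → 0 < γ →
      ∀ (D : InfiniteChainDynamics (pinnedChain ω₂ lam β γ)), D.carrier = (pinnedChain ω₂ lam β γ).bmGood →
      ∀ T T' : ℝ, 0 < T → 0 < T' → ∀ μ μ' : Measure ChainConfig,
        ((pinnedChain ω₂ lam β γ).IsChainGibbsMeasure T μ ∧ IsShiftInvariant μ ∧ D.PreservesMeasure μ ∧
          (∀ t : ℝ, D.HasAbsConvergentCorrelation μ t) ∧ Continuous (D.currentCorrelation μ) ∧
          ∀ t : ℝ, |D.currentCorrelation μ t| ≤ D.currentCorrelation μ 0) →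
        ((pinnedChain ω₂ lam β γ).IsChainGibbsMeasure T' μ' ∧ IsShiftInvariant μ' ∧ D.PreservesMeasure μ' ∧
          (∀ t : ℝ, D.HasAbsConvergentCorrelation μ' t) ∧ Continuous (D.currentCorrelation μ') ∧
          ∀ t : ℝ, |D.currentCorrelation μ' t| ≤ D.currentCorrelation μ' 0) →
        ∃ r : ℝ, Tendsto (fun ν : ℝ =>
            (∫ t in Ioi (0 : ℝ), Real.exp (-(ν * t)) * D.currentCorrelation μ t) /
              ∫ t in Ioi (0 : ℝ), Real.exp (-(ν * t)) * D.currentCorrelation μ' t)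
          (𝓝[>] (0 : ℝ)) (𝓝 r)) →
    Summit.AtomisticToContinuum.FouriersLaw.Theses.EmbeddedDrudeMourre.GreenKuboContinuation := by
  intro hA hB hK1 hK2 ω₂ lam β γ hω hl hβ hγ T₀ hT₀ hcorner T hT
  -- the heated pair: ONE dynamics (BM flow on `bmGood`) and shift-invariant Gibbs states at every T
  obtain ⟨D, hDc, hfam⟩ := hA ω₂ lam β γ hω hl hβ hγ
  -- seed temperature inside the corner, used exactly once
  have hT₁ : (0 : ℝ) < T₀ / 2 := by positivity
  have hT₁lt : T₀ / 2 < T₀ := by linarith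
  obtain ⟨μ₁, hμ₁⟩ := hfam (T₀ / 2) hT₁
  obtain ⟨μT, hμT⟩ := hfam T hT
  -- B: the physical pair at T₁ is a witness
  obtain ⟨κ₁, hκ₁, hseed⟩ :=
    hB ω₂ lam β γ hω hl hβ hγ (T₀ / 2) hT₁ (hcorner (T₀ / 2) hT₁ hT₁lt) D μ₁ hDc hμ₁
  -- K1 and K2′ at the pair (T, T₁)
  obtain ⟨m, hm, hbound⟩ := hK1 ω₂ lam β γ hω hl hβ hγ D hDc T (T₀ / 2) hT hT₁ μT μ₁ hμT hμ₁
  obtain ⟨r, hr⟩ := hK2 ω₂ lam β γ hω hl hβ hγ D hDc T (T₀ / 2) hT hT₁ μT μ₁ hμT hμ₁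
  -- real analysis of the transport
  have hT₁sq : (0 : ℝ) < (T₀ / 2) ^ 2 := by positivity
  -- the seed Abel functional tends to L₁ := (T₀/2)² κ₁ > 0
  have hA₁ : Tendsto (fun ν : ℝ => ∫ t in Ioi (0 : ℝ),
      Real.exp (-(ν * t)) * D.currentCorrelation μ₁ t) (𝓝[>] (0 : ℝ)) (𝓝 ((T₀ / 2) ^ 2 * κ₁)) := by
    have h := hseed.const_mul ((T₀ / 2) ^ 2)
    refine h.congr' (Eventually.of_forall fun ν => ?_)
    simp only
    rw [← mul_assoc, mul_inv_cancel₀ hT₁sq.ne', one_mul]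
  have hL₁ : (0 : ℝ) < (T₀ / 2) ^ 2 * κ₁ := mul_pos hT₁sq hκ₁
  -- eventually the seed functional is positive and ν ∈ (0, 1]
  have hpos : ∀ᶠ ν : ℝ in 𝓝[>] (0 : ℝ), 0 < ∫ t in Ioi (0 : ℝ),
      Real.exp (-(ν * t)) * D.currentCorrelation μ₁ t := hA₁.eventually_const_lt hL₁
  have hν : ∀ᶠ ν : ℝ in 𝓝[>] (0 : ℝ), ν ∈ Ioc (0 : ℝ) 1 := Ioc_mem_nhdsGT one_pos
  -- r ≥ m > 0
  have hmr : m ≤ r := by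
    refine ge_of_tendsto hr ?_
    filter_upwards [hpos, hν] with ν hp hn
    rw [le_div_iff₀ hp]
    exact hbound ν hn
  have hrpos : 0 < r := lt_of_lt_of_le hm hmr
  -- the target Abel functional tends to r · L₁
  have hAT : Tendsto (fun ν : ℝ => ∫ t in Ioi (0 : ℝ),
      Real.exp (-(ν * t)) * D.currentCorrelation μT t) (𝓝[>] (0 : ℝ))
      (𝓝 (r * ((T₀ / 2) ^ 2 * κ₁))) := by
    refine (hr.mul hA₁).congr' ?_
    filter_upwards [hpos] with ν hp
    exact div_mul_cancel₀ _ hp.ne'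
  -- assemble the witness at T
  refine ⟨μT, D, (T ^ 2)⁻¹ * (r * ((T₀ / 2) ^ 2 * κ₁)), hμT.1, hμT.2.2.1, hμT.2.2.2.1,
    mul_pos (inv_pos.mpr (pow_pos hT 2)) (mul_pos hrpos hL₁), ?_⟩
  exact hAT.const_mul ((T ^ 2)⁻¹)

/-- Sanity link for the audit: the composition applied to the four stubs proves the crux decl by
name (this term carries the stubs' sorries and is NOT a proof claim). -/
theorem GreenKuboContinuation_proof :
    Summit.AtomisticToContinuum.FouriersLaw.Theses.EmbeddedDrudeMourre.GreenKuboContinuation :=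
  GreenKuboContinuation_of stub_heatableInfrastructure stub_seedTransfer stub_boundedThermalExponent
    stub_thermalExponentConverges

end Summit.AtomisticToContinuum.FouriersLaw.Cruxes.GreenKuboContinuation.HeatedMeasureThermalExponent

end
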